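import Literature.Topology.FourManifolds.CorkDecompositionMiddleLevel
import Literature.Topology.FourManifolds.DisjointSpheresSlab
import HarnessLib

/-!
# Matveyev's printed form of the cork decomposition theorem from the current leaves

Topic `Literature/Topology/FourManifolds` (fact seat
`provefact-Literature.Topology.FourManifolds.Matveyev1996_decomposition`; bookkeeping companion of
`CorkDecompositionMiddleLevel.lean`, which does the same for the one-piece form
`Literature.Topology.FourManifolds.corkDecomposition`).

`Literature.Topology.FourManifolds.Matveyev1996_decomposition` (`CorkDecomposition.lean` §2) is
Matveyev's Theorem 1 in its printed two-piece form, parts 1–2 minus the `H₂` clause: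

> Matveyev, *A decomposition of smooth simply-connected h-cobordant 4-manifolds*,
> J. Differential Geom. 44 (1996) 571–582; arXiv:dg-ga/9505001, p. 1, **Theorem 1.** *Let `U` be
> a smooth, 5-dimensional, simply-connected h-cobordism with `∂U = M₁ ⊔ (−M₂)`. […] There are
> decompositions `M₁ = M #_Σ W₁`, `M₂ = M #_Σ W₂` […] `W₁`, `W₂` are smooth, compact,
> contractible 4-manifolds, and `Σ = ∂W₁ = ∂W₂ = ∂M`. These decompositions may be chosen so
> that `W₁` is diffeomorphic to `W₂`.*

It is formally *stronger* than the one-piece form `corkDecomposition` (which forgets the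
separation, countability, smoothness and compactness of the common exterior `M`,
`CorkDecomposition.lean` §3), so the reductions of `corkDecomposition` to the leaves of the DAG
recorded in `CorkDecompositionMilnor.lean` and `CorkDecompositionMiddleLevel.lean` do not by
themselves discharge it. This file records the same reductions for the printed form, with every
leaf that the tree has meanwhile proved already discharged:

* `Literature.Topology.FourManifolds.Matveyev1996_partOne_and_fact.matveyev1996_decomposition` —
  **parts 1–2 from part 1 with Fact 1 alone**: Matveyev's proof of part 2 (the splitting
  identity of fig. 2, boundary connected sums, `X # S⁴ ≅ X`, collars, seam adaptation) is
  entirely proved in the tree (`Matveyev1996_decomposition_of_partOne_fact_splitting`,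
  `CorkDecompositionAssembly.lean`; `exists_isConnectedSum_isBoundaryGluing_of_halfDiscs_of_seamAdapted`,
  `CorkDecompositionSplittingProof.lean`; `exists_seamAdaptedWitnesses_holds`,
  `SeamAdaptedWitnesses.lean`);
* `Literature.Topology.FourManifolds.matveyev1996_decomposition_of_middleLevel` — **the printed
  form from the current leaves**: **Milnor's Thm. 8.1 at one end**
  (`Literature.Topology.FourManifolds.Cobordism.Milnor1965_exists_isMorseFunction_two_le_index_left`),
  which with the discharged Thm. 2.5 `Cobordism.exists_isMorseFunction_holds`
  (`CobordismMorseFunctions.lean`) and Thm. 4.8 `Cobordism.Milnor1965_finalRearrangement_holds`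
  (`DisjointSpheresSlab.lean`, from Thm. 4.4 on a slab and Thms. 4.1–4.2 on a slab) gives the
  two-three handlebody of the first sentence of the printed proof
  (`Cobordism.IsHCobordism.exists_isMorseFunction_two_three_ordered_of_leaves`,
  `HCobordismHandlesTwoThree.lean`), then the middle level of that handlebody (B)
  `Literature.Topology.FourManifolds.exists_dualSpheres_middleLevel_of_two_three` and the
  four-dimensional construction from the middle level on (H4)
  `Literature.Topology.FourManifolds.Matveyev1996_partOne_and_fact_of_dualSpheres`
  (`CorkDecompositionMiddleLevel.lean`);
* `Literature.Topology.FourManifolds.corkDecomposition_of_eightOne_middleLevel` — the same for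
  the one-piece form, i.e. `corkDecomposition_of_middleLevel` with its hypothesis Thm. 4.4 on a
  slab discharged (`Cobordism.Milnor1965_exists_isGradientLike_disjoint_spheres_slab_holds`,
  `DisjointSpheresSlab.lean`).

So the DAG of the printed form reads: **`Matveyev1996_decomposition ⟸ Thm. 8.1 at one end ∧
(B) ∧ (H4)`** — one rung of 5-dimensional Smale–Milnor handle theory (the frontier of the
h-cobordism DAG, `HCobordismFrontier.lean`), the passage to the middle level, and the
four-dimensional construction in the middle level (Matveyev pp. 1–3 with Fact 1; Kirby 1996
§3 and Addenda (B), (C)). No statement is introduced here.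

**Merge of the handlebody form (2026-08-15, D-0026 review).**  This file used to factor the
reduction through the intermediate named fact `Matveyev1996_partOne_and_fact_of_two_three` of
`CorkDecompositionHandlebody.lean` (the conclusion of part 1 with Fact 1 for an h-cobordism
*equipped with* a two-three Morse function), via `matveyev1996_partOne_and_fact_of_eightOne` and
`matveyev1996_decomposition_of_eightOne_two_three`.  Its extra hypothesis — the first sentence
of the printed proof, handle trading in the 5-dimensional h-cobordism — being a theorem of the
tree now (`exists_isMorseFunction_two_three_of_isHCobordism_holds`, `HCobordismHandlesProofs.lean`),
that fact had become unconditionally equivalent to `Matveyev1996_partOne_and_fact` (the same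
proof obligation counted twice) and was merged back into it by the D-0026 review; the two
theorems mentioning it are withdrawn, and `matveyev1996_decomposition_of_middleLevel` passes to
the middle level directly.

## References

* R. Matveyev, *A decomposition of smooth simply-connected h-cobordant 4-manifolds*,
  J. Differential Geom. 44 (1996) 571–582; arXiv:dg-ga/9505001: Theorem 1 (p. 1), Proof of
  Theorem (pp. 1–2), Fact 1 and the proof of part 2 (p. 3). [Matveyev1996]
* R. Kirby, *Akbulut's corks and h-cobordisms of smooth, simply connected 4-manifolds*, Turkish
  J. Math. 20 (1996) 85–93; arXiv:math/9712231: Theorem, §2, §3, §4 Addenda (B), (C).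
  [KirbyCorks1996]
* C. L. Curtis, M. H. Freedman, W.-C. Hsiang, R. Stong, *A decomposition theorem for h-cobordant
  smooth simply-connected compact 4-manifolds*, Invent. Math. 123 (1996) 343–348, Theorem.
  [CurtisFreedmanHsiangStong1996]
* J. Milnor, *Lectures on the h-cobordism theorem*, Princeton (1965): Thm. 2.5, Thms. 4.4, 4.8,
  Thm. 8.1, proof of Thm. 9.1. [MilnorHCobordism1965]
-/

noncomputable section

namespace Literature.Topology.FourManifolds

universe u

/-! ### Parts 1–2 from part 1 with Fact 1 -/

/-- **Matveyev's Theorem 1, parts 1–2 (minus the `H₂` clause), from part 1 with Fact 1 alone.**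
The proof of part 2 printed on p. 3 — *"`M₁ = M #_Σ W₁ ≅ (M #_Σ W₁) # (W₁ #_Σ W₂) ≅
(M ♮ W₁) #_{Σ#Σ} (W₁ ♮ W₂)` and `M₂ = M #_Σ W₂ ≅ (M #_Σ W₂) # (W₁ #_Σ W₁) ≅
(M ♮ W₁) #_{Σ#Σ} (W₂ ♮ W₁)`. See figure 2"* — is entirely a theorem of the tree
(`Matveyev1996_decomposition_of_partOne_fact_splitting` with the splitting identity
`exists_isConnectedSum_isBoundaryGluing_of_halfDiscs_of_seamAdapted` and the discharged seam
adaptation `exists_seamAdaptedWitnesses_holds`), so the printed form follows from the single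
named fact `Literature.Topology.FourManifolds.Matveyev1996_partOne_and_fact` (part 1 together with Fact 1).
[cite: Matveyev1996, Theorem 1 and proof of part 2 with Fact 1 (arXiv pp. 1, 3)] -/
theorem Matveyev1996_partOne_and_fact.matveyev1996_decomposition
    (hB : Matveyev1996_partOne_and_fact.{u}) : Matveyev1996_decomposition.{u} :=
  Matveyev1996_decomposition_of_partOne_fact_splitting hB
    (exists_isConnectedSum_isBoundaryGluing_of_halfDiscs_of_seamAdapted
      exists_seamAdaptedWitnesses_holds exists_seamAdaptedWitnesses_holds)

/-! ### The printed form from the current leaves -/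

/-- **Matveyev's Theorem 1 (parts 1–2 minus the `H₂` clause) from the current leaves**: Milnor's
Thm. 8.1 at one end (`Literature.Topology.FourManifolds.Cobordism.Milnor1965_exists_isMorseFunction_two_le_index_left`), the
middle level of the two-three handlebody (B)
(`Literature.Topology.FourManifolds.exists_dualSpheres_middleLevel_of_two_three`) and the four-dimensional construction
from the middle level on (H4) (`Literature.Topology.FourManifolds.Matveyev1996_partOne_and_fact_of_dualSpheres`):
part 1 with Fact 1 is obtained by passing to the two-three handlebody of the first sentence of
the printed proof (Thm. 8.1 at one end `h81` with the discharged Thms. 2.5 and 4.8,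
`Cobordism.IsHCobordism.exists_isMorseFunction_two_three_ordered_of_leaves`), then to its middle
level (B), then applying (H4); part 2 is `Matveyev1996_partOne_and_fact.matveyev1996_decomposition`.
Once these three named facts are discharged, `Matveyev1996_decomposition` holds outright.
[cite: Matveyev1996, Theorem 1 and its proof (arXiv pp. 1–3)]
[cite: KirbyCorks1996, §§2–4: Theorem and Addenda (B), (C)]
[cite: MilnorHCobordism1965, Thm. 8.1 (PDF pp. 50–56), proof of Thm. 9.1 (PDF p. 57) with Thms. 2.5, 4.8] -/
theorem matveyev1996_decomposition_of_middleLevel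
    (h81 : Cobordism.Milnor1965_exists_isMorseFunction_two_le_index_left.{u})
    (hB : exists_dualSpheres_middleLevel_of_two_three.{u})
    (h4 : Matveyev1996_partOne_and_fact_of_dualSpheres.{u}) : Matveyev1996_decomposition.{u} := by
  refine Matveyev1996_partOne_and_fact.matveyev1996_decomposition ?_
  intro X₁ X₂ _ _ _ _ _ _ _ _ _ _ _ _ _ _ hcob
  obtain ⟨c, hc⟩ := hcob
  -- the two-three handlebody: Thm. 8.1 at one end with the discharged Thms. 2.5 and 4.8
  obtain ⟨f, hf, hind⟩ := hc.exists_isMorseFunction_two_three_ordered_of_leaves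
    (fun {_ _ _} _ _ _ _ => Cobordism.exists_isMorseFunction_holds) h81
    Cobordism.Milnor1965_finalRearrangement_holds
  -- its middle level (B), then the four-dimensional construction (H4)
  obtain ⟨N, _, _, _, _, _, _, _, oN, oS, oP, k, S, P, -, hD, hP, hS⟩ := hB X₁ X₂ c f hc hf hind
  exact h4 X₁ X₂ N oN oS oP k S P hD hP hS

/-- **The cork decomposition theorem from Thm. 8.1 at one end, (B) and (H4)** —
`corkDecomposition_of_middleLevel` (`CorkDecompositionMiddleLevel.lean`) with its hypothesis
Thm. 4.4 on a slab discharged (`Cobordism.Milnor1965_exists_isGradientLike_disjoint_spheres_slab_holds`,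
`DisjointSpheresSlab.lean`); equivalently, the printed form above followed by
`corkDecomposition_of_matveyev1996`. [cite: Matveyev1996, Theorem 1]
[cite: KirbyCorks1996, Theorem and Addenda (B)–(D)] [cite: MilnorHCobordism1965, Thm. 8.1] -/
theorem corkDecomposition_of_eightOne_middleLevel
    (h81 : Cobordism.Milnor1965_exists_isMorseFunction_two_le_index_left.{u})
    (hB : exists_dualSpheres_middleLevel_of_two_three.{u})
    (h4 : Matveyev1996_partOne_and_fact_of_dualSpheres.{u}) : corkDecomposition.{u} :=
  corkDecomposition_of_matveyev1996 (matveyev1996_decomposition_of_middleLevel h81 hB h4)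

end Literature.Topology.FourManifolds

end
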